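import Literature.NumberTheory.Automorphic.BianchiCuspidalEigenclass
import Literature.NumberTheory.Automorphic.AlgebraicWeightEigenvalueBound
import Literature.NumberTheory.Automorphic.AlgebraicWeightCharacterContinuity
import Literature.NumberTheory.Automorphic.TwistedQuotientCentralHecke
import Literature.NumberTheory.Automorphic.AlgebraicWeightFinitenessOfFP
import Literature.Algebra.Module.EigenvalueLattice
import HarnessLib

/-!
# `algebraicWeightEigenclass_continuousPoint` from the finiteness of `H^q(X_U, M̃)`

Topic `NumberTheory/Automorphic`; namespace `Literature.NumberTheory.Automorphic.AlgebraicWeight`.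
Theorems only; no named fact, no instance, no `sorry`.

**`algebraicWeightEigenclass_continuousPoint_of_finiteness`**: the named fact
`algebraicWeightEigenclass_continuousPoint` ([Scholze2015, Thm. V.4.1 / Cor. V.4.2] for the
completed-cohomology Hecke algebra of the tree) follows from the two finiteness properties of the
integral cohomology `H^q(Γ, indFun M_S) = H^q(X_U, M̃_S)` of the stage lattices that the printed
proof takes from the Borel–Serre compactification ("`X_K` is homotopy equivalent to a finite CW
complex", hence `H^i(X_K, 𝓜_{ξ,K})` is a finitely generated `ℤ_p`-module and
`H^i(X_K, 𝓜_{ξ,K}) ⊗ ℚ̄_p = H^i(X_K, 𝓜_{ξ,K} ⊗ ℚ̄_p)`):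

* `HX` — each `H^q(Γ, indFun M_S)` is module-finite over `ℤ_p`;
* `HU` — every class of `H^q(Γ, indFun V)` has a `p`-power multiple coming from some
  `H^q(Γ, indFun M_S)` (cohomology commutes with the directed union `V = ⋃ p^{-t} M_S`).

Everything else — the lattices, the reduction modulo `p^s`, the Hochschild–Serre / nilpotence
step, the Bockstein, the eigenvalue bound, the finite extension `E ∋ Q(a)`, continuity and the
extension to the closure — is proved in the tree (`AlgebraicWeight*`, `TwistedQuotient*` files);
this file is the assembly.  **`algebraicWeightEigenclass_continuousPoint_of_FP`** feeds `HX`, `HU`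
from `AlgebraicWeightFinitenessOfFP`: the named fact follows from the single statement `FP`
(finite-type free resolutions for the arithmetic subgroups of `GL_n(K)`,
[BorelSerre1973, §11.1]).

## References

* P. Scholze, *On torsion in the cohomology of locally symmetric varieties*, Ann. of Math. 182
  (2015), §V.4, Thm. V.4.1 and Cor. V.4.2. [Scholze2015]
* A. Borel, J.-P. Serre, *Corners and arithmetic groups*, Comment. Math. Helv. 48 (1973), §11.
  [BorelSerre1973]
-/

noncomputable section

open CategoryTheory
open IsDedekindDomain NumberField
open Literature.NumberTheory.Automorphic.BigHeckeGLn Literature.NumberTheory.Automorphic.TwistedQuotient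

namespace Literature.NumberTheory.Automorphic

namespace AlgebraicWeight

/-- **The eigenvalues on all the generators**: a simultaneous eigenvector `ξ₁ ≠ 0` of the
`T_{w,j}` (`w ∉ S`, `1 ≤ j ≤ n`, eigenvalues `a_{w,j}`) is an eigenvector of every generator
`T_{tᵢ}` of `𝕋(K^p)` with eigenvalue `genValue a i` (`T_{w,0} = 1`; `T_{w,j} = T_{w,n}` for
`j ≥ n`; `T_{w,n}⁻¹` acts by `a_{w,n}⁻¹`, `t_{w,n}` being central). [folklore] -/
theorem heckeEnd_genElement_of_eigen {n : ℕ} {K : Type} [Field K] [NumberField K] {p : ℕ}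
    [Fact p.Prime] (hn : 1 ≤ n) (𝒰 : TameLevel n K p) {V : Type} [AddCommGroup V]
    [Module (PadicAlgCl p) V] (ρ : Representation (PadicAlgCl p) (GL (Fin n) K) V) (q : ℕ)
    {ξ₁ : TwistedQuotient.cohomology (globalEmbedding n K) 𝒰.subgroup ρ q} (hξ0 : ξ₁ ≠ 0)
    (a : HeightOneSpectrum (𝓞 K) → ℕ → PadicAlgCl p)
    (hξ : ∀ w ∉ 𝒰.bad, ∀ j : ℕ, 1 ≤ j → j ≤ n →
      TwistedQuotient.heckeEnd (globalEmbedding n K) 𝒰.subgroup ρ (heckeElement n K w j) q ξ₁ =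
        a w j • ξ₁) (i : GenIndex 𝒰) :
    TwistedQuotient.heckeEnd (globalEmbedding n K) 𝒰.subgroup ρ (genElement 𝒰 i) q ξ₁ =
      genValue 𝒰 a i • ξ₁ := by
  -- `t_{w,0} = 1` and `t_{w,j} = t_{w,n}` for `j ≥ n` (the tree has these only in heavy or private form)
  have heckeElement_zero_eq_one : ∀ w : HeightOneSpectrum (𝓞 K), heckeElement n K w 0 = 1 := fun w => by
    have h : (fun k : Fin n => if k.val < 0 then uniformizerIdele K w (uniformizerAt w) else 1) = 1 :=
      funext fun k => if_neg (Nat.not_lt_zero _)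
    rw [heckeElement, h, map_one]
  have heckeElement_of_le : ∀ (w : HeightOneSpectrum (𝓞 K)) {j : ℕ}, n ≤ j →
      heckeElement n K w j = heckeElement n K w n := fun w j hj => by
    unfold heckeElement
    congr 1
    funext k
    rw [if_pos (lt_of_lt_of_le k.isLt hj), if_pos k.isLt]
  rcases i with ⟨v, i⟩ | v
  · rw [genElement_inl]
    change _ = (if i = 0 then (1 : PadicAlgCl p) else a v (min i n)) • ξ₁
    rcases Nat.eq_zero_or_pos i with rfl | hi
    · rw [if_pos rfl, one_smul, heckeElement_zero_eq_one]
      change (TwistedQuotient.heckeOperator (globalEmbedding n K) 𝒰.subgroup ρ 1 q).hom ξ₁ = ξ₁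
      rw [TwistedQuotient.heckeOperator_one]
      rfl
    · rw [if_neg (Nat.pos_iff_ne_zero.1 hi)]
      by_cases hin : i ≤ n
      · rw [min_eq_left hin]
        exact hξ v v.2 i hi hin
      · rw [min_eq_right (le_of_not_ge hin), heckeElement_of_le (v : HeightOneSpectrum (𝓞 K))
          (le_of_not_ge hin)]
        exact hξ v v.2 n hn le_rfl
  · rw [genElement_inr]
    change _ = (a v n)⁻¹ • ξ₁
    exact (TwistedQuotient.heckeEnd_inv_eq_inv_smul_of_eigen (globalEmbedding n K) 𝒰.subgroup ρ
      (fun x => heckeElement_self_mul_comm (v : HeightOneSpectrum (𝓞 K)) x) q hξ0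
      (hξ v v.2 n hn le_rfl)).2

/-- **`algebraicWeightEigenclass_continuousPoint` from the finiteness of the integral cohomology.**
Hypotheses: `HX` — `H^q(Γ, indFun M_S)` is a finitely generated `ℤ_p`-module for every integral
stage `S`; `HU` — every class in `H^q(Γ, indFun V)` has a `p`-power multiple in the image of some
`H^q(Γ, indFun M_S)`.  Both are the Borel–Serre finiteness of `X_U` [cite: BorelSerre1973, §11.1]
as used in [cite: Scholze2015, §V.4 (proof of Thm. V.4.1)]; granted them, the conclusion is the
printed argument of [cite: Scholze2015, Thm. V.4.1 and Cor. V.4.2]. -/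
theorem algebraicWeightEigenclass_continuousPoint_of_finiteness
    (HX : ∀ (K : Type) [Field K] [NumberField K] (n p : ℕ) [Fact p.Prime]
      (lam : (K →+* PadicAlgCl p) → Fin n → ℤ) (𝒰 : TameLevel n K p) (S : Finset (PadicAlgCl p)),
      (∀ c ∈ S, ‖c‖ ≤ 1) → ∀ q : ℕ,
      Module.Finite ℤ_[p] (groupCohomology (indFun (globalEmbedding n K) 𝒰.subgroup
        (latticeRep 𝒰.subgroup (padicIntRep K n p lam) (stageLattice K n p lam S)
          (stageLattice_stable K n p lam 𝒰 S))) q))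
    (HU : ∀ (K : Type) [Field K] [NumberField K] (n p : ℕ) [Fact p.Prime]
      (lam : (K →+* PadicAlgCl p) → Fin n → ℤ) (𝒰 : TameLevel n K p) (q : ℕ)
      (y : groupCohomology (indFun (globalEmbedding n K) 𝒰.subgroup
        (latticeRep 𝒰.subgroup (padicIntRep K n p lam) ⊤ (top_stable' K n p lam 𝒰.subgroup))) q),
      ∃ S : Finset (PadicAlgCl p), (∀ c ∈ S, ‖c‖ ≤ 1) ∧ ∃ (c : ℕ)
        (z : groupCohomology (indFun (globalEmbedding n K) 𝒰.subgroup
          (latticeRep 𝒰.subgroup (padicIntRep K n p lam) (stageLattice K n p lam S)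
            (stageLattice_stable K n p lam 𝒰 S))) q),
        ((groupCohomology.functor ℤ_[p] (GL (Fin n) K) q).map
          (indInclTop K n p lam 𝒰.subgroup (stageLattice K n p lam S)
            (stageLattice_stable K n p lam 𝒰 S))).hom z = (((p ^ c : ℕ) : ℤ_[p])) • y) :
    algebraicWeightEigenclass_continuousPoint := by
  intro K _ _ n p _ hn 𝒰 wt _hdom ρ hρ q ξ hξ a ha
  have hp : (p : ℕ).Prime := Fact.out
  -- Step 1: `ξ` as a class with coefficients `padicCoeffRep ∘ ι`
  obtain ⟨ξ₁, hξ₁0, hξ₁⟩ : ∃ ξ₁ : TwistedQuotient.cohomology (globalEmbedding n K) 𝒰.subgroup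
      ((ResGLnCohomology.padicCoeffRep n K p wt).comp (globalEmbedding n K)) q,
      ξ₁ ≠ 0 ∧ ∀ w ∉ 𝒰.bad, ∀ j : ℕ, 1 ≤ j → j ≤ n →
        TwistedQuotient.heckeEnd (globalEmbedding n K) 𝒰.subgroup _ (heckeElement n K w j) q ξ₁ =
          a w j • ξ₁ :=
    ⟨(ResGLnCohomology.cohomologyIsoPadic n K p wt 𝒰.subgroup hρ q).inv.hom ξ,
      ResGLnCohomology.cohomologyIsoPadic_inv_apply_ne_zero n K p wt 𝒰.subgroup hρ q hξ,
      fun w hw j h1 hj => by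
        rw [← ResGLnCohomology.cohomologyIsoPadic_inv_heckeEnd, ha w hw j h1 hj, map_smul]⟩
  -- Step 2: eigenvalues on all generators
  have hgen := heckeEnd_genElement_of_eigen hn 𝒰 _ q hξ₁0 a hξ₁
  -- Step 3: the integral class `ξ_⊤` and a stage `S` with `p^c ξ₁ ∈ L_S`
  obtain ⟨ξT, hξT⟩ := (realizeTop_bijective K n p wt 𝒰.subgroup q).2 ξ₁
  obtain ⟨S, hS, c, z, hz⟩ := HU K n p wt 𝒰 q ξT
  have hmem : ((p : PadicAlgCl p) ^ c) • ξ₁ ∈ realizeRange K n p wt 𝒰.subgroup q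
      (stageLattice K n p wt S) (stageLattice_stable K n p wt 𝒰 S) := by
    refine (mem_realizeRange_iff K n p wt 𝒰.subgroup q _ _ _).2 ⟨z, ?_⟩
    rw [realize_apply, hz, LinearMap.map_smulₛₗ, hξT, map_natCast, Nat.cast_pow]
  haveI := HX K n p wt 𝒰 S hS q
  have hfg := realizeRange_fg K n p wt 𝒰.subgroup q (stageLattice K n p wt S)
    (stageLattice_stable K n p wt 𝒰 S)
  -- Step 4: the bound `‖Q(a)‖^{q+1} ≤ ‖p‖^s` for `Q(T)` small
  have hbd : ∀ s : ℕ, ∃ r : ℕ, ∀ Q : FreeRing (GenIndex 𝒰),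
      (∀ b ≤ q, genPoly 𝒰 Q (r, s, b) = 0) →
        ‖FreeRing.lift (genValue 𝒰 a) Q‖ ^ (q + 1) ≤ ‖(p : PadicAlgCl p)‖ ^ s := by
    intro s
    obtain ⟨r, hr⟩ := norm_pow_succ_le_of_heckeOperator_eq_zero K n p wt 𝒰 hS s q (genElement 𝒰)
      (padicCoeffRep_genElement 𝒰 wt) (genElement_hconj 𝒰) (genElement_hbij 𝒰)
    exact ⟨r, fun Q hQ => hr Q hQ ξ₁ (genValue 𝒰 a) hξ₁0 hgen hfg c hmem⟩
  -- Step 5: all `Q(a)` lie in one finite extension `E/ℚ_p`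
  have hη0 : ((p : PadicAlgCl p) ^ c) • ξ₁ ≠ 0 :=
    smul_ne_zero (pow_ne_zero c (Nat.cast_ne_zero.2 hp.ne_zero)) hξ₁0
  have hgenη : ∀ i : GenIndex 𝒰, TwistedQuotient.heckeEnd (globalEmbedding n K) 𝒰.subgroup _
      (genElement 𝒰 i) q (((p : PadicAlgCl p) ^ c) • ξ₁) =
        genValue 𝒰 a i • (((p : PadicAlgCl p) ^ c) • ξ₁) := fun i => by
    rw [map_smul, hgen i, smul_comm]
  obtain ⟨E, hEfd, hE⟩ := Literature.Algebra.Module.exists_intermediateField_forall_eigenvalue_mem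
    (R := ℤ_[p]) (k' := PadicAlgCl p)
    (realizeRange K n p wt 𝒰.subgroup q (stageLattice K n p wt S) (stageLattice_stable K n p wt 𝒰 S))
    (((p : PadicAlgCl p) ^ c) • ξ₁) ℚ_[p] hfg hmem hη0
  haveI := hEfd
  have hEQ : ∀ Q : FreeRing (GenIndex 𝒰), FreeRing.lift (genValue 𝒰 a) Q ∈ E := fun Q =>
    hE (heckePolyEnd K n p wt 𝒰.subgroup (genElement 𝒰) q Q)
      (fun v hv => by
        obtain ⟨x, rfl⟩ := (mem_realizeRange_iff K n p wt 𝒰.subgroup q _ _ v).1 hv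
        rw [← realize_heckePolyIndEnd K n p wt 𝒰.subgroup _ _ (genElement 𝒰)
          (padicCoeffRep_genElement 𝒰 wt) q Q x]
        exact realize_mem_realizeRange K n p wt 𝒰.subgroup q _ _ _)
      _ (heckePolyEnd_apply_of_eigen K n p wt 𝒰.subgroup q (genElement 𝒰) (genValue 𝒰 a) hgenη Q)
  -- Step 6: continuity and extension
  obtain ⟨x, hxc, hx⟩ := exists_continuous_ringHom_of_bound 𝒰 a q hbd E hEQ
  exact ⟨x, hxc, hx⟩

/-- **`algebraicWeightEigenclass_continuousPoint` from `FP`**: the named fact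
[cite: Scholze2015, Thm. V.4.1 and Cor. V.4.2] follows from the existence of projective
resolutions of finite type for the arithmetic subgroups of `GL_n(K)` (Borel–Serre,
[cite: BorelSerre1973, §11.1]; [cite: Brown1982CohomologyGroups, VIII.9]) — the hypothesis `hFP`. -/
theorem algebraicWeightEigenclass_continuousPoint_of_FP
    (hFP : ∀ (K : Type) [Field K] [NumberField K] (n : ℕ) (Γx : Subgroup (GL (Fin n) K)),
      Γx.Commensurable (Matrix.GeneralLinearGroup.map (algebraMap (𝓞 K) K) :
        GL (Fin n) (𝓞 K) →* GL (Fin n) K).range →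
      ∀ (k : Type) [CommRing k], ∃ P : ProjectiveResolution (Rep.trivial k Γx k),
        ∀ i, ∃ m : ℕ, Nonempty (P.complex.X i ≅ Rep.free k Γx (Fin m))) :
    algebraicWeightEigenclass_continuousPoint :=
  algebraicWeightEigenclass_continuousPoint_of_finiteness
    (fun K _ _ n p _ lam 𝒰 _ hS q =>
      moduleFinite_cohomology_indFun_stageLattice_of_FP K n p lam hFP 𝒰 hS q)
    (fun K _ _ n p _ lam 𝒰 q y => exists_stage_of_FP K n p lam hFP 𝒰 q y)

end AlgebraicWeight

end Literature.NumberTheory.Automorphic
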